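import Summits.ResolutionOfSingularities.ResolutionOfSingularities.Theorems.FrobeniusClosingSteerSwitchingSetup
import Literature.AlgebraicGeometry.Resolution.RsopMonomialIdeals
import Mathlib.RingTheory.Ideal.Height
import HarnessLib

/-!
# Crux `Steer` (stmt-16345), line `switching_dichotomy` r8: the quadratic sequence and the greedy torsor run (stub `stub_core4RunTrichotomy`)

OURS (campaign `res-hironaka`, rung L, slot W4.1, chain W4.1; replaces the role of no printed item; NOT a
statement of the manuscript under review). This file PROVES the registered r8 stub
`stub_core4RunTrichotomy` (skeleton `Cruxes/Steer/Lines/switching_dichotomy.lean` reshape r8, sha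
fca30952a2ff20db, registered 2026-08-26T22:11:37Z on stmt-ResolutionOfSingularities-16345), with its r8
vocabulary (`IsExcParam`, `IsStrictStep`, `IsTorsorRunUpTo`, `IsTorsorRun`, `CanStep`, `OrderOneAt`)
INLINED verbatim, so that the leaf consumes it by definitional unfolding:

for a datum `t ^ p ∈ A₀ ⊆ O` regular at a centre of dimension `≥ 3`, the quadratic sequence `R` of the
base along `O` exists (`R 0 = (A₀)_{𝔪_O ∩ A₀}`, each `R (i+1)` the quadratic transform of `R i` along
`O`), and the GREEDY TORSOR RUN of `t` along `R` — `s 0 = t`, `s (i+1)` any strict transform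
`s i = x * s (i+1) + g` (`x` an exceptional parameter of `R i`, `g ∈ R i`) with `s (i+1) ^ p ∈ R (i+1)`,
as long as one exists — is ETERNAL, or reaches a stage in ORDER-ONE form, or STALLS at a stage that is
neither steppable nor of order one.

Proof. (1) `¬ dim ≤ 2` forces the centre `𝔪_O ∩ A₀` to be non-zero (else the local ring of the base at
the centre is the localization of a domain at `⊥`, of Krull dimension `height ⊥ = 0`), giving the
hypothesis `∃ a ∈ A₀, a ≠ 0, v a < 1` of the landed `stub_switchingSetup`, which supplies `R`. (2) The
trichotomy is pure logic plus recursion: `CanStep` at stage `N` depends on `s N` only, so if no finite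
run ever stalls or reaches order one, `Nat.rec` with `Classical.choose` builds an eternal run. [folklore]
-/

-- layout-mandated namespace `Summit.<Summit>.<Problem>.…` with Summit = Problem (single-conjunct summit)
set_option linter.dupNamespace false

namespace Summit.ResolutionOfSingularities.ResolutionOfSingularities.Theorems.SwitchingDichotomy

open Literature.AlgebraicGeometry.Resolution

/-- **The centre is non-zero in dimension `≥ 3`** (indeed `≥ 1`): if the local ring of the base `A₀ ⊆ O`
at the centre of `O` does not have Krull dimension `≤ 2`, some non-zero `a ∈ A₀` has `v a < 1`.
(Otherwise the centre `𝔪_O ∩ A₀` is `⊥` and the local ring has dimension `height ⊥ = 0`.) [folklore] -/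
theorem exists_mem_centre_of_not_ringKrullDim_le_two {k K : Type} [Field k] [Field K] [Algebra k K]
    (O : ValuationSubring K) (A₀ : Subalgebra k K) (h₀ : A₀.toSubring ≤ O.toSubring)
    (hdim2 : ¬ ringKrullDim (Localization.AtPrime
      (Ideal.comap (Subring.inclusion h₀) (IsLocalRing.maximalIdeal O))) ≤ 2) :
    ∃ a ∈ A₀, a ≠ 0 ∧ O.valuation a < 1 := by
  by_contra hne
  apply hdim2
  set I := Ideal.comap (Subring.inclusion h₀) (IsLocalRing.maximalIdeal O) with hI
  have hIbot : I ≤ ⊥ := fun x hx => by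
    rw [Ideal.mem_bot]
    by_contra hx0
    refine hne ⟨x, x.2, fun h => hx0 (Subtype.ext h), ?_⟩
    exact (ValuationSubring.valuation_lt_one_iff O (Subring.inclusion h₀ x)).mp (Ideal.mem_comap.mp hx)
  have hh : I.height = 0 :=
    nonpos_iff_eq_zero.mp ((Ideal.height_mono hIbot).trans (le_of_eq Ideal.height_bot))
  rw [IsLocalization.AtPrime.ringKrullDim_eq_height I (Localization.AtPrime I), hh]
  norm_num

/-- **`stub_core4RunTrichotomy` (line `switching_dichotomy`, reshape r8; registered statement, r8
vocabulary unfolded verbatim).** For `t ^ p ∈ A₀ ⊆ O` with the base regular at a centre of dimension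
`≥ 3`: the quadratic sequence `R` of the base along `O` exists, and the greedy torsor run of `t` along
`R` is eternal, or reaches a stage in order-one form, or stalls at a stage that is neither steppable nor
of order one. [folklore] -/
theorem stub_core4RunTrichotomy :
    ∀ (p : ℕ) (k K : Type) [Field k] [Field K] [Algebra k K]
      (O : ValuationSubring K) (A₀ : Subalgebra k K) (h₀ : A₀.toSubring ≤ O.toSubring) (t : K),
      t ^ p ∈ A₀ →
      IsRegularLocalRing (Localization.AtPrime
        (Ideal.comap (Subring.inclusion h₀) (IsLocalRing.maximalIdeal O))) →
      ¬ ringKrullDim (Localization.AtPrime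
        (Ideal.comap (Subring.inclusion h₀) (IsLocalRing.maximalIdeal O))) ≤ 2 →
      ∃ R : ℕ → Subring K, R 0 = locAtCentre A₀.toSubring O ∧
        (∀ i, IsQuadraticTransformAlong O (R i) (R (i + 1))) ∧
        ((∃ s : ℕ → K, s 0 = t ∧ (∀ i, s i ^ p ∈ R i) ∧
            ∀ i, ∃ x g : K, (x ∈ R i ∧ x ≠ 0 ∧ O.valuation x < 1 ∧
              ∀ y ∈ R i, O.valuation y < 1 → O.valuation y ≤ O.valuation x) ∧
              g ∈ R i ∧ s i = x * s (i + 1) + g) ∨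
          (∃ (s : ℕ → K) (N : ℕ),
            (s 0 = t ∧ (∀ i ≤ N, s i ^ p ∈ R i) ∧
              ∀ i < N, ∃ x g : K, (x ∈ R i ∧ x ≠ 0 ∧ O.valuation x < 1 ∧
                ∀ y ∈ R i, O.valuation y < 1 → O.valuation y ≤ O.valuation x) ∧
                g ∈ R i ∧ s i = x * s (i + 1) + g) ∧
            ∃ g ∈ R N, ∃ (_ : IsLocalRing (R N)) (z : Fin 1 → R N), IsRsopPart z ∧
              ((z 0 : R N) : K) = s N ^ p - g ^ p) ∨
          (∃ (s : ℕ → K) (N : ℕ),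
            (s 0 = t ∧ (∀ i ≤ N, s i ^ p ∈ R i) ∧
              ∀ i < N, ∃ x g : K, (x ∈ R i ∧ x ≠ 0 ∧ O.valuation x < 1 ∧
                ∀ y ∈ R i, O.valuation y < 1 → O.valuation y ≤ O.valuation x) ∧
                g ∈ R i ∧ s i = x * s (i + 1) + g) ∧
            ¬ (∃ s' : K, (∃ x g : K, (x ∈ R N ∧ x ≠ 0 ∧ O.valuation x < 1 ∧
                ∀ y ∈ R N, O.valuation y < 1 → O.valuation y ≤ O.valuation x) ∧
                g ∈ R N ∧ s N = x * s' + g) ∧ s' ^ p ∈ R (N + 1)) ∧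
            ¬ (∃ g ∈ R N, ∃ (_ : IsLocalRing (R N)) (z : Fin 1 → R N), IsRsopPart z ∧
              ((z 0 : R N) : K) = s N ^ p - g ^ p))) := by
  intro p k K _ _ _ O A₀ h₀ t htp hreg hdim2
  classical
  -- (1) the quadratic sequence of the base along `O`
  obtain ⟨R, hR0, hRq, -, -, -⟩ := stub_switchingSetup k K O A₀ h₀ hreg
    (exists_mem_centre_of_not_ringKrullDim_le_two O A₀ h₀ hdim2)
  refine ⟨R, hR0, hRq, ?_⟩
  have htR0 : t ^ p ∈ R 0 := by
    rw [hR0]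
    exact le_locAtCentre A₀.toSubring O htp
  -- local names for the r8 vocabulary
  set Step : Subring K → K → K → Prop := fun S s s' => ∃ x g : K, (x ∈ S ∧ x ≠ 0 ∧
    O.valuation x < 1 ∧ ∀ y ∈ S, O.valuation y < 1 → O.valuation y ≤ O.valuation x) ∧
    g ∈ S ∧ s = x * s' + g with hStep
  set RunUpTo : (ℕ → K) → ℕ → Prop := fun s N =>
    s 0 = t ∧ (∀ i ≤ N, s i ^ p ∈ R i) ∧ ∀ i < N, Step (R i) (s i) (s (i + 1)) with hRunUpTo
  set OrderOne : (ℕ → K) → ℕ → Prop := fun s N =>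
    ∃ g ∈ R N, ∃ (_ : IsLocalRing (R N)) (z : Fin 1 → R N), IsRsopPart z ∧
      ((z 0 : R N) : K) = s N ^ p - g ^ p with hOrderOne
  set Can : (ℕ → K) → ℕ → Prop := fun s N =>
    ∃ s' : K, Step (R N) (s N) s' ∧ s' ^ p ∈ R (N + 1) with hCan
  change (∃ s : ℕ → K, s 0 = t ∧ (∀ i, s i ^ p ∈ R i) ∧ ∀ i, Step (R i) (s i) (s (i + 1))) ∨
    (∃ (s : ℕ → K) (N : ℕ), RunUpTo s N ∧ OrderOne s N) ∨
    (∃ (s : ℕ → K) (N : ℕ), RunUpTo s N ∧ ¬ Can s N ∧ ¬ OrderOne s N)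
  by_contra hnot
  have hA : ∀ s : ℕ → K, ¬ (s 0 = t ∧ (∀ i, s i ^ p ∈ R i) ∧ ∀ i, Step (R i) (s i) (s (i + 1))) :=
    fun s h => hnot (Or.inl ⟨s, h⟩)
  have hB : ∀ s N, RunUpTo s N → ¬ OrderOne s N := fun s N h1 h2 =>
    hnot (Or.inr (Or.inl ⟨s, N, h1, h2⟩))
  have hC : ∀ s N, RunUpTo s N → Can s N := fun s N h1 => by
    by_contra h3
    exact hnot (Or.inr (Or.inr ⟨s, N, h1, h3, hB s N h1⟩))
  -- (2) the greedy run: `CanStep` at stage `N` depends on `s N` only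
  let e : ℕ → K := fun n => Nat.rec (motive := fun _ => K) t
    (fun N eN => if h : ∃ s' : K, Step (R N) eN s' ∧ s' ^ p ∈ R (N + 1) then Classical.choose h
      else 0) n
  have he0 : e 0 = t := rfl
  have heS : ∀ N, e (N + 1) = if h : ∃ s' : K, Step (R N) (e N) s' ∧ s' ^ p ∈ R (N + 1)
      then Classical.choose h else 0 := fun N => rfl
  have hrun : ∀ N, RunUpTo e N := by
    intro N
    induction N with
    | zero =>
      refine ⟨he0, fun i hi => ?_, fun i hi => absurd hi (Nat.not_lt_zero i)⟩
      rw [Nat.le_zero.mp hi, he0]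
      exact htR0
    | succ N ih =>
      have hcan : ∃ s' : K, Step (R N) (e N) s' ∧ s' ^ p ∈ R (N + 1) := hC e N ih
      have hspec := Classical.choose_spec hcan
      have heN : e (N + 1) = Classical.choose hcan := by rw [heS N, dif_pos hcan]
      refine ⟨he0, fun i hi => ?_, fun i hi => ?_⟩
      · rcases Nat.lt_or_eq_of_le hi with hi | rfl
        · exact ih.2.1 i (Nat.lt_succ_iff.mp hi)
        · rw [heN]; exact hspec.2
      · rcases Nat.lt_or_eq_of_le (Nat.lt_succ_iff.mp hi) with hi | rfl
        · exact ih.2.2 i hi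
        · rw [heN]; exact hspec.1
  exact hA e ⟨he0, fun i => (hrun i).2.1 i le_rfl, fun i => (hrun (i + 1)).2.2 i (Nat.lt_succ_self i)⟩

end Summit.ResolutionOfSingularities.ResolutionOfSingularities.Theorems.SwitchingDichotomy
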